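import Summits.QuantumFields.BalabanUV.Beta.SymmetrisedAxialGaugeBlockMean

/-!
# `BalabanUV.Beta.FP.BlockMeanProjectorGrad` — road «FP» for binder row D1, (STEP) door, RULING R-FP-45 located fact (9b) as a kernel theorem:
# THE LITERAL's DRESSING PROJECTOR ON PURE GAUGES — `Π^{sym}_bm (grad f) = grad (blockMean f)`; hence it KILLS `grad f` for `f` of ZERO BLOCK MEAN and FIXES `grad f` for
# BLOCK-CONSTANT `f` (the dichotomy that puts road FP's step defect on the COARSE gauge modes, memo `N2B-DESIGN.md` v2 §9 (9b); letter (i) of row NESTED-DRESS at m = 1)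

HONEST DEPENDENCY (page 1, mandatory): continuum YM on T⁴ ⇐ BetaPertH ∧ nine spine estimates (0/9 proved); BetaPertH ⇐ (D1) ∧ (D4) ∧ CAP+tail;
G-an2-4 gates asym, D1 and NE2/3/4.  HONEST FRAMING (cell contract, verbatim): «discharging `BetaPertH` makes Bałaban's UV stability UNCONDITIONAL —
a real constructive-QFT result; it is NOT the continuum limit and NOT the Clay problem.»  THIS MODULE DISCHARGES NOTHING of the wall: [folklore] lattice
calculus over an2's `symAxProjBmAt` ∕ `symBmGaugeAt` ∕ `symGaugeAt` (`SymmetrisedAxialGaugeBlockMean`) and `blockMeanAt` (`AxialProjectorBlockMean`), by name from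
`SymmetrisedAxialGauge.symTreeGaugeAt_grad` (the tree integral of an exact form).  No `def`, no `def … : Prop`, nothing cited, 0 sorry; 0∕4 row-D1 binders;
NOT SDF, NOT D1, NOT BetaPertH, NOT continuum, NOT Clay.  «not in print; our bookkeeping».

ABSOLUTE RULE (cell charter, verbatim): «No internally-minted statement may enter as a cited fact. Every hypothesis is either kernel-proved in this package or a
verbatim quotation of a PUBLISHED theorem with page reference. The manuscript(s) under audit are NOT citable for their own disputed steps — they are the thing
under adjudication; programme-internal (2001/route/tribunal) claims are never citable.»

CONTENTS (all [folklore]; `ρ` any root, blocking `N ≥ 1`).  `symGaugeAt_grad` (`symGaugeAt ρ (grad f) N x = f x − f (N•blk x + ρ)`), `blockMeanAt_rootConst`,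
`blockMeanAt_sub`, `blockMeanAt_eq_self_of_blockConst`, **`symBmGaugeAt_grad`** (`= f − blockMeanAt N f`), **`symAxProjBmAt_grad`** (`Π^{sym}_bm (grad f) = grad (blockMeanAt N f)`),
**`symAxProjBmAt_grad_eq_zero_of_blockMean_zero`**, **`symAxProjBmAt_grad_of_blockConst`**.
Provenance: road FP OWNER b2b-balaban-beta-d1-p3 gen 14 (prover-b2b-balaban-beta-d1-p3-g14-0), 2026-08-21; memo §9 (9b), PROPOSED RULING R-FP-45 (B′) letter (i) at m = 1.
-/

namespace Summit.QuantumFields.BalabanUV.Beta.FP.BlockMeanProjectorGrad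

noncomputable section

open Finset
open scoped BigOperators Nat
open Literature.MathematicalPhysics.QuantumFieldTheory.Balaban1983to89.Beta
open AffineAveraging (Form0 Form1 Site box toSite blockSum)
open AveragingContours (grad blk blk_block)
open Summit.QuantumFields.BalabanUV.Beta.AxialProjectorBlockMean (blockMeanAt grad_sub)
open Summit.QuantumFields.BalabanUV.Beta.SymmetrisedAxialPotential (symTreeGaugeAt)
open Summit.QuantumFields.BalabanUV.Beta.SymmetrisedAxialGauge (symTreeGaugeAt_grad)
open Summit.QuantumFields.BalabanUV.Beta.SymmetrisedAxialGaugeBlockMean (symGaugeAt symBmGaugeAt symAxProjBmAt)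

variable {d : ℕ}

/-- [folklore] The normalised symmetrised tree gauge of an EXACT form: `symGaugeAt ρ (grad f) N x = f x − f (N•blk N x + ρ)` (by `symTreeGaugeAt_grad`). -/
theorem symGaugeAt_grad (ρ : Site d) (f : Form0 d ℝ) (N : ℕ) :
    symGaugeAt ρ (grad f) N = fun x => f x - f ((N : ℤ) • blk N x + ρ) := by
  funext x
  show (d ! : ℝ)⁻¹ * symTreeGaugeAt ρ (grad f) N x = _
  rw [symTreeGaugeAt_grad, ← mul_assoc, inv_mul_cancel₀ (by exact_mod_cast Nat.factorial_ne_zero d), one_mul]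

/-- [folklore] The block mean of a function read at the block roots is that function (`N ≥ 1`). -/
theorem blockMeanAt_rootConst {N : ℕ} (hN : 1 ≤ N) (ρ : Site d) (f : Form0 d ℝ) :
    blockMeanAt N (fun x => f ((N : ℤ) • blk N x + ρ)) = fun x => f ((N : ℤ) • blk N x + ρ) := by
  funext x
  have hblk : ∀ b ∈ box d N, blk N ((N : ℤ) • blk N x + toSite b) = blk N x := fun b hb => blk_block (blk N x) hb
  have hcard : (box d N).card = N ^ d := by
    simp only [AffineAveraging.box, Fintype.card_piFinset, Finset.card_range, Finset.prod_const, Finset.card_univ, Fintype.card_fin]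
  have hNn : ((N : ℝ) ^ d) ≠ 0 := pow_ne_zero _ (by exact_mod_cast (show N ≠ 0 by omega))
  show (∑ b ∈ box d N, f ((N : ℤ) • blk N ((N : ℤ) • blk N x + toSite b) + ρ)) / ((N : ℝ) ^ d) = _
  rw [Finset.sum_congr rfl fun b hb => by rw [hblk b hb], Finset.sum_const, hcard, nsmul_eq_mul]
  push_cast
  field_simp

/-- [folklore] `blockMeanAt` is additive-group linear: `blockMeanAt N (f − g) = blockMeanAt N f − blockMeanAt N g`. -/
theorem blockMeanAt_sub (N : ℕ) (f g : Form0 d ℝ) : blockMeanAt N (f - g) = blockMeanAt N f - blockMeanAt N g := by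
  funext x
  show (∑ b ∈ box d N, (f - g) ((N : ℤ) • blk N x + toSite b)) / ((N : ℝ) ^ d) =
    (∑ b ∈ box d N, f ((N : ℤ) • blk N x + toSite b)) / ((N : ℝ) ^ d) - (∑ b ∈ box d N, g ((N : ℤ) • blk N x + toSite b)) / ((N : ℝ) ^ d)
  simp only [Pi.sub_apply, Finset.sum_sub_distrib, sub_div]

/-- [folklore] A block-constant function is its own block mean (`N ≥ 1`). -/
theorem blockMeanAt_eq_self_of_blockConst {N : ℕ} (hN : 1 ≤ N) {f : Form0 d ℝ} (hf : ∀ x, f x = f ((N : ℤ) • blk N x)) :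
    blockMeanAt N f = f := by
  have hfe : f = fun x => f ((N : ℤ) • blk N x + 0) := by funext x; rw [add_zero]; exact hf x
  rw [hfe]
  exact blockMeanAt_rootConst hN 0 f

/-- [folklore] **THE BLOCK-MEAN-NORMALISED PARAMETER OF AN EXACT FORM**: `symBmGaugeAt ρ (grad f) N = f − blockMeanAt N f` (`N ≥ 1`; root-independent). -/
theorem symBmGaugeAt_grad {N : ℕ} (hN : 1 ≤ N) (ρ : Site d) (f : Form0 d ℝ) :
    symBmGaugeAt ρ (grad f) N = f - blockMeanAt N f := by
  unfold symBmGaugeAt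
  rw [symGaugeAt_grad]
  have hsplit : (fun x => f x - f ((N : ℤ) • blk N x + ρ)) = f - (fun x => f ((N : ℤ) • blk N x + ρ)) := rfl
  rw [hsplit, blockMeanAt_sub, blockMeanAt_rootConst hN ρ f]
  abel

/-- [folklore] **THE DRESSING PROJECTOR ON PURE GAUGES**: `Π^{sym}_bm (grad f) = grad (blockMeanAt N f)` (`N ≥ 1`). -/
theorem symAxProjBmAt_grad {N : ℕ} (hN : 1 ≤ N) (ρ : Site d) (f : Form0 d ℝ) :
    symAxProjBmAt ρ N (grad f) = grad (blockMeanAt N f) := by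
  unfold symAxProjBmAt
  rw [symBmGaugeAt_grad hN, grad_sub]
  abel

/-- [folklore] **… KILLS the pure gauges with parameter of ZERO BLOCK MEAN** (the fine gauge modes `Θ_N`). -/
theorem symAxProjBmAt_grad_eq_zero_of_blockMean_zero {N : ℕ} (hN : 1 ≤ N) (ρ : Site d) {f : Form0 d ℝ}
    (hf : blockMeanAt N f = 0) : symAxProjBmAt ρ N (grad f) = 0 := by
  rw [symAxProjBmAt_grad hN, hf]
  funext κ x
  simp [grad]

/-- [folklore] **… and FIXES the pure gauges with BLOCK-CONSTANT parameter** (the coarse gauge modes). -/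
theorem symAxProjBmAt_grad_of_blockConst {N : ℕ} (hN : 1 ≤ N) (ρ : Site d) {f : Form0 d ℝ}
    (hf : ∀ x, f x = f ((N : ℤ) • blk N x)) : symAxProjBmAt ρ N (grad f) = grad f := by
  rw [symAxProjBmAt_grad hN, blockMeanAt_eq_self_of_blockConst hN hf]

end

end Summit.QuantumFields.BalabanUV.Beta.FP.BlockMeanProjectorGrad
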